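import Mathlib
import Literature.Probability.LatticeModels.GKSInequalities
import Summits.CriticalPhenomena.Ising3DConformalLimit.Theorems.PrecisionLaplacianInverseMFerromagnetLevelTwo
import HarnessLib

/-!
# Crux `PrecisionLaplacian.InverseMFerromagnet` (stmt-CriticalPhenomena-4798), line `Sketch` —
# stub `helper_odd_gram_duality` (duality of the odd Gram matrices at couplings `K` and `-K`)

THEOREM-ONLY file (no definitions).  For the zero-field pair system `gksExpect univ K C`
(`|C i| = 2`, couplings `K` of any sign) on `n` sites, the "odd Gram matrix"
`Φ^K_{S,T} = ⟨σ_S σ_T⟩_K` (`T` ranging over the odd subsets of the sites) satisfies the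
group-Fourier identity on `(ℤ/2)ⁿ`
  `∑_{T odd} ⟨σ_S σ_T⟩_K ⟨σ_T σ_U⟩_{-K} = [S = U] · 4ⁿ / (Z_K Z_{-K})`     (`U` odd),
i.e. `Φ^K Φ^{-K} = (4ⁿ / (Z_K Z_{-K})) · Id`: the inverse of the ferromagnetic odd Gram matrix is
the ANTIferromagnetic one.  Proof: writing both expectations as configuration sums, the `T`-sum is
the character-type sum `∑_{T odd} σ_T(ω) σ_T(ω') = 2ⁿ⁻¹ ([ω' = ω] − [ω' = −ω])`
(`ogd_sum_odd_spinProduct`, from `∑_T ∏_{i∈T} x_i = ∏ (1 + x_i)` and its signed version); the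
diagonal `ω' = ω` carries the weight `e^{H(ω)} e^{-H(ω)} = 1`, the antidiagonal `ω' = -ω` the same
weight (pair interactions are flip-invariant) and the sign `σ_U(-ω) = -σ_U(ω)`; what is left is
`2ⁿ ∑_ω σ_{S ∆ U}(ω) = 4ⁿ [S = U]`.  This is the algebraic half of the proof of `Law₂` on four
sites (the other half is the entrywise sign of the antiferromagnetic precision matrix).
-/

namespace Summit.CriticalPhenomena.Ising3DConformalLimit.Cruxes.InverseMFerromagnet.PartialCovarianceLadder

open Literature.Probability.LatticeModels Finset Matrix
open scoped symmDiff

/-! ## The character sum over odd subsets -/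

/-- Odd part of the subset generating function: `∑_{|T| odd} ∏_{i∈T} x_i = (∏(1+x_i) − ∏(1−x_i))/2`.
[folklore] -/
theorem ogd_sum_odd_prod {n : ℕ} (x : Fin n → ℝ) :
    ∑ T ∈ (Finset.univ : Finset (Fin n)).powerset.filter (fun T => Odd T.card), ∏ i ∈ T, x i
      = ((∏ i, (1 + x i)) - ∏ i, (1 - x i)) / 2 := by
  have h1 : ∏ i, (1 + x i) = ∑ T ∈ (Finset.univ : Finset (Fin n)).powerset, ∏ i ∈ T, x i :=
    Finset.prod_one_add _
  have h2 : ∏ i, (1 - x i) = ∑ T ∈ (Finset.univ : Finset (Fin n)).powerset, ∏ i ∈ T, -x i := by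
    simp_rw [sub_eq_add_neg]
    exact Finset.prod_one_add _
  rw [h1, h2, ← Finset.sum_sub_distrib, Finset.sum_filter, eq_div_iff two_ne_zero,
    Finset.sum_mul]
  refine Finset.sum_congr rfl fun T _ => ?_
  rw [Finset.prod_neg]
  rcases Nat.even_or_odd T.card with h | h
  · rw [if_neg (Nat.not_odd_iff_even.2 h), h.neg_one_pow]
    ring
  · rw [if_pos h, h.neg_one_pow]
    ring

/-- `∏_i (1 + σ_i(ω) σ_i(ω')) = 2ⁿ [ω' = ω]`. [folklore] -/
theorem ogd_prod_one_add_spin {n : ℕ} (ω ω' : SpinConfig (Fin n)) :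
    ∏ i, (1 + spinAt i ω * spinAt i ω') = if ω' = ω then (2 : ℝ) ^ n else 0 := by
  split_ifs with h
  · subst h
    simp only [spinAt_mul_self]
    rw [Finset.prod_const, Finset.card_univ, Fintype.card_fin]
    norm_num
  · obtain ⟨i, hi⟩ : ∃ i, ω' i ≠ ω i := by
      by_contra hcon
      push Not at hcon
      exact h (funext hcon)
    refine Finset.prod_eq_zero (Finset.mem_univ i) ?_
    unfold spinAt
    rcases Int.units_eq_one_or (ω i) with h1 | h1 <;>
      rcases Int.units_eq_one_or (ω' i) with h2 | h2 <;> simp_all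

/-- `∏_i (1 − σ_i(ω) σ_i(ω')) = 2ⁿ [ω' = −ω]`. [folklore] -/
theorem ogd_prod_one_sub_spin {n : ℕ} (ω ω' : SpinConfig (Fin n)) :
    ∏ i, (1 - spinAt i ω * spinAt i ω') = if ω' = -ω then (2 : ℝ) ^ n else 0 := by
  split_ifs with h
  · subst h
    simp only [l2_spinAt_neg, mul_neg, spinAt_mul_self, sub_neg_eq_add]
    rw [Finset.prod_const, Finset.card_univ, Fintype.card_fin]
    norm_num
  · obtain ⟨i, hi⟩ : ∃ i, ω' i ≠ -ω i := by
      by_contra hcon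
      push Not at hcon
      exact h (funext hcon)
    refine Finset.prod_eq_zero (Finset.mem_univ i) ?_
    unfold spinAt
    rcases Int.units_eq_one_or (ω i) with h1 | h1 <;>
      rcases Int.units_eq_one_or (ω' i) with h2 | h2 <;> simp_all

/-- **Character sum over odd subsets**: `∑_{|T| odd} σ_T(ω) σ_T(ω') = 2ⁿ⁻¹ ([ω' = ω] − [ω' = −ω])`
(for `n = 0` both brackets are `1` and the sum is empty). [folklore] -/
theorem ogd_sum_odd_spinProduct {n : ℕ} (ω ω' : SpinConfig (Fin n)) :
    ∑ T ∈ (Finset.univ : Finset (Fin n)).powerset.filter (fun T => Odd T.card),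
        spinProduct T ω * spinProduct T ω'
      = ((if ω' = ω then (2 : ℝ) ^ n else 0) - (if ω' = -ω then (2 : ℝ) ^ n else 0)) / 2 := by
  simp only [spinProduct, ← Finset.prod_mul_distrib]
  rw [ogd_sum_odd_prod (fun i => spinAt i ω * spinAt i ω'), ogd_prod_one_add_spin,
    ogd_prod_one_sub_spin]

/-- `∑_{ω'} c(ω') · 2ⁿ⁻¹([ω' = ω] − [ω' = −ω]) = 2ⁿ⁻¹ (c(ω) − c(−ω))`. [folklore] -/
theorem ogd_sum_mul_key {n : ℕ} (c : SpinConfig (Fin n) → ℝ) (ω : SpinConfig (Fin n)) :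
    ∑ ω', c ω' * (((if ω' = ω then (2 : ℝ) ^ n else 0) - (if ω' = -ω then (2 : ℝ) ^ n else 0)) / 2)
      = (2 : ℝ) ^ n / 2 * (c ω - c (-ω)) := by
  have h : ∀ ω' : SpinConfig (Fin n),
      c ω' * (((if ω' = ω then (2 : ℝ) ^ n else 0) - (if ω' = -ω then (2 : ℝ) ^ n else 0)) / 2)
        = (if ω' = ω then c ω' * 2 ^ n / 2 else 0)
            - (if ω' = -ω then c ω' * 2 ^ n / 2 else 0) := by
    intro ω'
    split_ifs <;> ring
  simp_rw [h]
  rw [Finset.sum_sub_distrib, Fintype.sum_ite_eq', Fintype.sum_ite_eq']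
  ring

/-! ## `∑_ω σ_D(ω) = 2ⁿ [D = ∅]` -/

/-- Flipping the spin at a site `x ∈ D` negates `σ_D`. [folklore] -/
theorem ogd_spinProduct_mul_mulSingle {n : ℕ} (D : Finset (Fin n)) {x : Fin n} (hx : x ∈ D)
    (ω : SpinConfig (Fin n)) :
    spinProduct D (ω * Pi.mulSingle x (-1 : ℤˣ)) = -spinProduct D ω := by
  rw [spinProduct_mul_cfg]
  suffices h : spinProduct D (Pi.mulSingle x (-1 : ℤˣ) : SpinConfig (Fin n)) = -1 by
    rw [h]
    ring
  unfold spinProduct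
  rw [← Finset.mul_prod_erase D _ hx]
  have h1 : spinAt x (Pi.mulSingle x (-1 : ℤˣ) : SpinConfig (Fin n)) = -1 := by
    simp [spinAt]
  have h2 : ∀ i ∈ D.erase x, spinAt i (Pi.mulSingle x (-1 : ℤˣ) : SpinConfig (Fin n)) = 1 := by
    intro i hi
    simp [spinAt, Pi.mulSingle_eq_of_ne (Finset.ne_of_mem_erase hi)]
  rw [h1, Finset.prod_eq_one h2]
  ring

/-- `∑_ω σ_D(ω) = 2ⁿ` if `D = ∅` and `0` otherwise (pair `ω` with its flip at a site of `D`).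
[folklore] -/
theorem ogd_sum_spinProduct {n : ℕ} (D : Finset (Fin n)) :
    ∑ ω : SpinConfig (Fin n), spinProduct D ω = if D = ∅ then (2 : ℝ) ^ n else 0 := by
  split_ifs with h
  · subst h
    simp only [spinProduct_empty, Finset.sum_const, Finset.card_univ, nsmul_eq_mul, mul_one,
      Fintype.card_fun, Fintype.card_units_int, Fintype.card_fin]
    push_cast
    rfl
  · obtain ⟨x, hx⟩ := Finset.nonempty_iff_ne_empty.2 h
    have hsum := Equiv.sum_comp (Equiv.mulRight (Pi.mulSingle x (-1 : ℤˣ))) (spinProduct D)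
    simp only [Equiv.coe_mulRight, ogd_spinProduct_mul_mulSingle D hx,
      Finset.sum_neg_distrib] at hsum
    linarith

/-! ## The duality -/

/-- `e^{H_K(ω)} e^{H_{-K}(ω)} = 1`. [folklore] -/
theorem ogd_gksWeight_mul_neg {n m : ℕ} (K : Fin m → ℝ) (C : Fin m → Finset (Fin n))
    (ω : SpinConfig (Fin n)) :
    gksWeight Finset.univ K C ω * gksWeight Finset.univ (fun i => -K i) C ω = 1 := by
  simp only [gksWeight, gksHamiltonian, neg_mul, Finset.sum_neg_distrib, ← Real.exp_add,
    add_neg_cancel, Real.exp_zero]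

/-- The duality with abstract weights: if `w ω · w' ω = 1`, `w' (-ω) = w' ω` and `U` is odd, then
`∑_{T odd} (∑_ω σ_S σ_T w) (∑_ω σ_T σ_U w') = 4ⁿ [S = U]`. [folklore] -/
theorem ogd_core {n : ℕ} (w w' : SpinConfig (Fin n) → ℝ) (hww' : ∀ ω, w ω * w' ω = 1)
    (hw' : ∀ ω, w' (-ω) = w' ω) (S U : Finset (Fin n)) (hU : Odd U.card) :
    ∑ T ∈ (Finset.univ : Finset (Fin n)).powerset.filter (fun T => Odd T.card),
        (∑ ω, spinProduct S ω * spinProduct T ω * w ω)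
          * (∑ ω, spinProduct T ω * spinProduct U ω * w' ω)
      = if S = U then (4 : ℝ) ^ n else 0 := by
  have hUneg : ∀ ω : SpinConfig (Fin n), spinProduct U (-ω) = -spinProduct U ω := fun ω => by
    rw [spinProduct_neg, hU.neg_one_pow]
    ring
  simp_rw [Finset.sum_mul_sum]
  rw [Finset.sum_comm]
  have hinner : ∀ ω : SpinConfig (Fin n),
      ∑ T ∈ (Finset.univ : Finset (Fin n)).powerset.filter (fun T => Odd T.card),
        ∑ ω', spinProduct S ω * spinProduct T ω * w ω
          * (spinProduct T ω' * spinProduct U ω' * w' ω')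
        = (2 : ℝ) ^ n * spinProduct (S ∆ U) ω := by
    intro ω
    rw [Finset.sum_comm]
    have h1 : ∀ ω' : SpinConfig (Fin n),
        ∑ T ∈ (Finset.univ : Finset (Fin n)).powerset.filter (fun T => Odd T.card),
          spinProduct S ω * spinProduct T ω * w ω
            * (spinProduct T ω' * spinProduct U ω' * w' ω')
          = (spinProduct S ω * w ω * (spinProduct U ω' * w' ω')) *
              ∑ T ∈ (Finset.univ : Finset (Fin n)).powerset.filter (fun T => Odd T.card),
                spinProduct T ω * spinProduct T ω' := by
      intro ω'
      rw [Finset.mul_sum]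
      exact Finset.sum_congr rfl fun T _ => by ring
    simp_rw [h1, ogd_sum_odd_spinProduct]
    rw [ogd_sum_mul_key, hUneg, hw', ← spinProduct_mul_eq_spinProduct_symmDiff]
    linear_combination (2 : ℝ) ^ n * (spinProduct S ω * spinProduct U ω) * hww' ω
  simp_rw [hinner]
  rw [← Finset.mul_sum, ogd_sum_spinProduct]
  simp only [Finset.symmDiff_eq_empty]
  split_ifs
  · rw [← mul_pow]
    norm_num
  · simp

/-- The duality for the numerators `Z_K ⟨·⟩_K`, `Z_{-K} ⟨·⟩_{-K}` of a pair system. [folklore] -/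
theorem ogd_numerator {n m : ℕ} (K : Fin m → ℝ) (C : Fin m → Finset (Fin n))
    (hC : ∀ i, (C i).card = 2) (S U : Finset (Fin n)) (hU : Odd U.card) :
    ∑ T ∈ (Finset.univ : Finset (Fin n)).powerset.filter (fun T => Odd T.card),
        gksSum Finset.univ K C (fun ω => spinProduct S ω * spinProduct T ω)
          * gksSum Finset.univ (fun i => -K i) C (fun ω => spinProduct T ω * spinProduct U ω)
      = if S = U then (4 : ℝ) ^ n else 0 := by
  simp only [gksSum]
  exact ogd_core _ _ (ogd_gksWeight_mul_neg K C) (l2_gksWeight_neg (fun i => -K i) C hC) S U hU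

/-- **Odd Gram duality** (stub `helper_odd_gram_duality` of line `Sketch`): for a pair system
(`|C i| = 2`) on `n` sites and `U` odd,
`∑_{T odd} ⟨σ_S σ_T⟩_K ⟨σ_T σ_U⟩_{-K} = [S = U] · 4ⁿ / (Z_K Z_{-K})`. [folklore] -/
theorem helper_odd_gram_duality :
    ∀ (n m : ℕ) (K : Fin m → ℝ) (C : Fin m → Finset (Fin n)), (∀ i, (C i).card = 2) →
      ∀ (S U : Finset (Fin n)), Odd U.card →
        ∑ T ∈ (Finset.univ : Finset (Fin n)).powerset.filter (fun T => Odd T.card),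
            gksExpect Finset.univ K C (fun ω => spinProduct S ω * spinProduct T ω)
              * gksExpect Finset.univ (fun i => -K i) C (fun ω => spinProduct T ω * spinProduct U ω)
          = if S = U then (4 : ℝ) ^ n / (gksSum Finset.univ K C (fun _ => 1)
              * gksSum Finset.univ (fun i => -K i) C (fun _ => 1)) else 0 := by
  intro n m K C hC S U hU
  have hnum := ogd_numerator K C hC S U hU
  simp only [gksExpect, div_mul_div_comm, ← Finset.sum_div, hnum]
  split_ifs
  · rfl
  · exact zero_div _

end Summit.CriticalPhenomena.Ising3DConformalLimit.Cruxes.InverseMFerromagnet.PartialCovarianceLadder
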